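import Mathlib
import Summits.Langlands.Langlands.Theses.PhantomRMYoshida
import Summits.Langlands.Langlands.Theorems.PhantomRMYoshidaStableYoshidaCongruenceNonConjIdle
import Summits.Langlands.Langlands.Theorems.PhantomRMYoshidaStableYoshidaCongruenceResidualLattice
import Summits.Langlands.Langlands.Theorems.PhantomRMYoshidaStableYoshidaCongruenceOrdinaryFrameFp
import Literature.NumberTheory.NumberFields.CongruenceSubgroupTorsionFree
import HarnessLib

/-!
# Route `PhantomRMYoshida`, crux `StableYoshidaCongruence` (stmt-Langlands-13640): the crux HOLDS,
# vacuously, at every pair that is indistinguishable at `p` or not ordinary-shaped at `p`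

Helper file (`--supports stmt-Langlands-13640`, line lead c20, 2026-08-17; sequel of `…NonConjIdle.lean`,
p155497).  It does NOT close the crux; it proves the crux AT a class of data.

**Local rigidity of the witness** (`no_witness_of_local_charpoly_eq`).  `p` odd, `det σ = ε̄⁻¹`, `v ∣ p`.
If `σ` and `σ'` have the same characteristic polynomials on the decomposition group at `v`
(`charpoly σ'(τ) = charpoly σ(τ)` for `τ` in the image of `Γ_{ℚ_v} → Γ_ℚ`; e.g. `σ'|_{Γ_{ℚ_v}} ≅ σ|_{Γ_{ℚ_v}}`),
then NO `ρ : Γ_ℚ → GL₄(ℚ̄_p)` is Greenberg-ordinary of shape `(0,0,1,1)` and residually distinguished at `v`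
with residual pair `(σ, σ')`.  The proof is that of `nonConj_of_det_of_ordinary_of_hasResidualPair`
(file `…NonConjIdle.lean`), which only ever used the conjugacy `σ' = g σ g⁻¹` through this local
consequence: in the residual model `M` of `stub_residualLattice` the two unramified top characters
`a ≠ d` are roots of `charpoly M(τ) = (charpoly σ(τ))²` on `Γ_{ℚ_v}`, so `det σ(τ) = a(τ) d(τ)` wherever
`a(τ) ≠ d(τ)`, an inertia-invariant quantity, while `det σ = ε̄⁻¹` moves under an inertia element with
`ε̄ ≠ 1`.

**Consequences for the crux** (vocabulary `CruxAt`/`Sh`/`DetCond` of the landed sector file, verbatim the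
route's `let`s; `StableYoshidaCongruence ↔ ∀ data, CruxAt` is `crux_iff`, `Iff.rfl`):
* `cruxAt_of_local_charpoly_eq` — at such a pair the witness hypothesis `∃ ρ, Sh ρ` is unsatisfiable, so
  the crux's instance `CruxAt p k red σ σ'` HOLDS;
* `cruxAt_of_twist_trivial_at_p` — in particular for TWIST PAIRS `σ' = σ ⊗ η` by a character `η` that is
  trivial on the decomposition group at `p` (e.g. `η` quadratic cutting out a field in which `p` splits):
  this is regime R1 (`p` split) of the standing disprover's table (`Cruxes/StableYoshidaCongruence/Disproof.lean`
  §5: "p split or ramified in E ⇒ no witness (vacuous)"), now kernel-checked for the split case and for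
  any `η` with `η|_{Γ_{ℚ_p}} = 1`;
* `cruxAt_of_finrank_invariants_inertia_ne_one` — likewise at every pair one of whose members is NOT
  ordinary-shaped at `p` (its inertia invariants at `v ∣ p` are not a line: unramified at `p`, or
  supersingular-type), by the landed orientation lemma `finrank_invariants_inertia_eq_one` (p117060):
  Disproof §4's "supersingular pairs have no ordinary lift at all", kernel-checked.
[folklore]
-/

set_option linter.dupNamespace false -- `Summit.Langlands.Langlands` is the mandated namespace (D-0017)

noncomputable section

open Literature.NumberTheory.GaloisRepresentations Literature.NumberTheory.Automorphic
open IsDedekindDomain Matrix Polynomial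
open scoped NumberField
open Summit.Langlands.Langlands.Theses.PhantomRMYoshida
open Summit.Langlands.Langlands.Cruxes.StableYoshidaCongruence.LevelThreeWeierstrassSwitch
  (epsBar Sh AutGL2 AutGL4 DetCond NonConj CruxAt crux_iff)
open Summit.Langlands.Langlands.Cruxes.StableYoshidaCongruence.BurkhardtWeddleTwoThreeAnchor
  (stub_residualLattice exists_mem_absInertia_epsBar_ne_one det_val_eq_of_det_eq
    finrank_invariants_inertia_eq_one)

namespace Summit.Langlands.Langlands.Theorems.PhantomRMYoshida

section Main

variable {p : ℕ} [Fact p.Prime] {k : Type} [Field k] [CharP k p] [TopologicalSpace k]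
  [DiscreteTopology k]

/-- **Local rigidity of the witness.**  `p` odd; `det σ = ε̄⁻¹`; `v ∣ p`; `σ` and `σ'` have the same
characteristic polynomials on the image of `Γ_{ℚ_v} → Γ_ℚ`.  Then no `ρ : Γ_ℚ → GL₄(ℚ̄_p)` is
Greenberg-ordinary `(0,0,1,1)` and residually distinguished at `v` with residual pair `(σ, σ')` through
`red`. [folklore] -/
theorem no_witness_of_local_charpoly_eq (hp : p ≠ 2)
    {red : Valued.integer (PadicAlgCl p) →+* k} {σ σ' : FramedGaloisRep ℚ k 2}
    (hdet : ∀ g, FramedRep.det σ g =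
      (Units.map (ZMod.castHom (dvd_refl p) k).toMonoidHom (epsBar p g))⁻¹)
    (v : HeightOneSpectrum (𝓞 ℚ)) (hv : ((p : ℕ) : 𝓞 ℚ) ∈ v.asIdeal)
    (hloc : ∀ τ : Field.absoluteGaloisGroup (v.adicCompletion ℚ),
      FramedRep.charpoly σ' (absGaloisRestrict ℚ (v.adicCompletion ℚ) τ) =
        FramedRep.charpoly σ (absGaloisRestrict ℚ (v.adicCompletion ℚ) τ))
    {ρ : FramedGaloisRep ℚ (PadicAlgCl p) 4}
    (hGr : ρ.IsGreenbergOrdinaryOfShapeAt v ![0, 0, 1, 1])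
    (hdist : ρ.IsResiduallyDistinguishedAt v ![0, 0, 1, 1])
    (hpair : ρ.HasResidualPair red σ σ') : False := by
  -- adapted from `nonConj_of_det_of_ordinary_of_hasResidualPair` (file `…NonConjIdle.lean`)
  obtain ⟨M, hM1, hM2, hM3, τ₀, hτ₀⟩ := stub_residualLattice p hp k red σ σ' ρ v hv hGr hdist hpair
  obtain ⟨ι, hιI, hι⟩ := exists_mem_absInertia_epsBar_ne_one hp v hv
  set L := absGaloisRestrict ℚ (v.adicCompletion ℚ) with hL
  -- KEY: wherever the two top characters differ, `det σ = a d`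
  have key : ∀ τ : Field.absoluteGaloisGroup (v.adicCompletion ℚ),
      (M.toLocal v τ).val 0 0 ≠ (M.toLocal v τ).val 1 1 →
      ((σ (L τ) : GL (Fin 2) k) : Matrix (Fin 2) (Fin 2) k).det =
        (M.toLocal v τ).val 0 0 * (M.toLocal v τ).val 1 1 := by
    intro τ hne
    obtain ⟨h10, h20, h30, h21, h31⟩ := hM2 τ
    have hroots := charpoly_eval_diag_eq_zero_of_blockShape (M.toLocal v τ).val h10 h20 h30 h21 h31
    have hfac : ((M.toLocal v τ).val).charpoly =
        FramedRep.charpoly σ (L τ) * FramedRep.charpoly σ (L τ) := by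
      have h := hM1 (L τ)
      rw [hloc] at h
      exact h
    set S := ((σ (L τ) : GL (Fin 2) k) : Matrix (Fin 2) (Fin 2) k) with hS
    have hP : FramedRep.charpoly σ (L τ) = X ^ 2 - C S.trace * X + C S.det :=
      Matrix.charpoly_fin_two S
    have ha : (X ^ 2 - C S.trace * X + C S.det : k[X]).eval ((M.toLocal v τ).val 0 0) = 0 := by
      have h := hroots.1
      rw [hfac, eval_mul, hP] at h
      exact mul_self_eq_zero.mp h
    have hd : (X ^ 2 - C S.trace * X + C S.det : k[X]).eval ((M.toLocal v τ).val 1 1) = 0 := by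
      have h := hroots.2
      rw [hfac, eval_mul, hP] at h
      exact mul_self_eq_zero.mp h
    simp only [eval_add, eval_sub, eval_mul, eval_pow, eval_C, eval_X] at ha hd
    have hsub : ((M.toLocal v τ).val 0 0 - (M.toLocal v τ).val 1 1) *
        ((M.toLocal v τ).val 0 0 + (M.toLocal v τ).val 1 1 - S.trace) = 0 := by
      linear_combination ha - hd
    have ht : S.trace - ((M.toLocal v τ).val 0 0 + (M.toLocal v τ).val 1 1) = 0 := by
      have h := (mul_eq_zero.mp hsub).resolve_left (sub_ne_zero.mpr hne)
      linear_combination -h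
    linear_combination ha + ((M.toLocal v τ).val 0 0) * ht
  -- the top characters do not see inertia
  have h00 : (M.toLocal v (τ₀ * ι)).val 0 0 = (M.toLocal v τ₀).val 0 0 := by
    obtain ⟨h10, h20, h30, -, -⟩ := hM2 ι
    obtain ⟨hι00, -, -⟩ := hM3 ι hιI
    rw [map_mul, Units.val_mul, Matrix.mul_apply, Fin.sum_univ_four, h10, h20, h30, hι00]
    ring
  have h11 : (M.toLocal v (τ₀ * ι)).val 1 1 = (M.toLocal v τ₀).val 1 1 := by
    obtain ⟨-, -, -, h21, h31⟩ := hM2 ι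
    obtain ⟨-, hι11, hι01⟩ := hM3 ι hιI
    rw [map_mul, Units.val_mul, Matrix.mul_apply, Fin.sum_univ_four, h21, h31, hι11, hι01]
    ring
  -- compare `det σ` at `τ₀` and at `τ₀ ι`
  have h1 := key τ₀ hτ₀
  have h2 := key (τ₀ * ι) (by rwa [h00, h11])
  rw [h00, h11, ← h1, map_mul, map_mul, Matrix.GeneralLinearGroup.coe_mul, Matrix.det_mul] at h2
  have hunit : ((σ (L τ₀) : GL (Fin 2) k) : Matrix (Fin 2) (Fin 2) k).det ≠ 0 := by
    rw [← Matrix.GeneralLinearGroup.val_det_apply]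
    exact Units.ne_zero _
  have hone : ((σ (L ι) : GL (Fin 2) k) : Matrix (Fin 2) (Fin 2) k).det = 1 := by
    have h3 : ((σ (L τ₀) : GL (Fin 2) k) : Matrix (Fin 2) (Fin 2) k).det *
        (((σ (L ι) : GL (Fin 2) k) : Matrix (Fin 2) (Fin 2) k).det - 1) = 0 := by
      linear_combination h2
    exact sub_eq_zero.mp ((mul_eq_zero.mp h3).resolve_left hunit)
  rw [det_val_eq_of_det_eq (hdet (L ι)), ← map_one (ZMod.castHom (dvd_refl p) k)] at hone
  have hinj := (ZMod.castHom_injective k) hone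
  exact hι (inv_eq_one.mp (Units.ext hinj))

/-- **The crux holds at every locally indistinguishable pair** (vacuously: no `Sh`-witness exists).
`p` odd; if for some `v ∣ p` the characteristic polynomials of `σ` and `σ'` agree on the image of
`Γ_{ℚ_v}`, then `CruxAt p k red σ σ'` — the route's crux at the datum `(p, k, red, σ, σ')`
(`crux_iff`). [folklore] -/
theorem cruxAt_of_local_charpoly_eq (hp : p ≠ 2) {red : Valued.integer (PadicAlgCl p) →+* k}
    {σ σ' : FramedGaloisRep ℚ k 2} (v : HeightOneSpectrum (𝓞 ℚ)) (hv : ((p : ℕ) : 𝓞 ℚ) ∈ v.asIdeal)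
    (hloc : ∀ τ : Field.absoluteGaloisGroup (v.adicCompletion ℚ),
      FramedRep.charpoly σ' (absGaloisRestrict ℚ (v.adicCompletion ℚ) τ) =
        FramedRep.charpoly σ (absGaloisRestrict ℚ (v.adicCompletion ℚ) τ)) :
    CruxAt p k red σ σ' := by
  intro _ _ _ _ hdet _ hw _ _
  obtain ⟨ρ, hρ⟩ := hw
  exact (no_witness_of_local_charpoly_eq hp (fun g => (hdet g).1) v hv hloc (hρ.2.1 v hv).1
    (hρ.2.1 v hv).2 hρ.2.2).elim

/-- **Twist pairs trivial at `p` (regime R1, `p` split).**  `p` odd; `σ' = σ ⊗ η` entrywise for a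
character `η : Γ_ℚ → kˣ` that is trivial on the image of `Γ_{ℚ_v}`, `v ∣ p` (e.g. `η` the quadratic
character of a field in which `p` splits).  Then the crux holds at `(p, k, red, σ, σ')`, vacuously.
[folklore] -/
theorem cruxAt_of_twist_trivial_at_p (hp : p ≠ 2) {red : Valued.integer (PadicAlgCl p) →+* k}
    {σ σ' : FramedGaloisRep ℚ k 2} (η : Field.absoluteGaloisGroup ℚ →* kˣ)
    (hη : ∀ x, ((σ' x : GL (Fin 2) k) : Matrix (Fin 2) (Fin 2) k) =
      ((η x : kˣ) : k) • ((σ x : GL (Fin 2) k) : Matrix (Fin 2) (Fin 2) k))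
    (v : HeightOneSpectrum (𝓞 ℚ)) (hv : ((p : ℕ) : 𝓞 ℚ) ∈ v.asIdeal)
    (hηv : ∀ τ : Field.absoluteGaloisGroup (v.adicCompletion ℚ),
      η (absGaloisRestrict ℚ (v.adicCompletion ℚ) τ) = 1) :
    CruxAt p k red σ σ' :=
  cruxAt_of_local_charpoly_eq hp v hv fun τ => by
    simp only [FramedRep.charpoly]
    rw [hη, hηv τ, Units.val_one, one_smul]

/-- **The crux holds at every pair that is NOT ordinary-shaped at `p`** (vacuously).  `p` odd; if for
some `v ∣ p` the inertia invariants of `σ` (through `Γ_{ℚ_v} → Γ_ℚ`) are not a line — e.g. `σ`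
unramified at `p` (a plane) or `σ|_{Γ_{ℚ_v}}` irreducible / supersingular-type (zero) — or the same for
`σ'`, then `CruxAt p k red σ σ'`.  Indeed any `Sh`-witness forces both spaces to be lines: the landed
orientation lemma `finrank_invariants_inertia_eq_one` (p117060; Brauer–Nesbitt on the residual model of
`stub_residualLattice`), whose `DetCond` input is now supplied from `det σ = ε̄⁻¹` alone
(`detCond_of_det_of_sh` is not needed: `CruxAt` carries `DetCond`).  This is Disproof §4's remark
"supersingular pairs have no ordinary lift at all", kernel-checked. [folklore] -/
theorem cruxAt_of_finrank_invariants_inertia_ne_one (hp : p ≠ 2)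
    {red : Valued.integer (PadicAlgCl p) →+* k} {σ σ' : FramedGaloisRep ℚ k 2}
    (v : HeightOneSpectrum (𝓞 ℚ)) (hv : ((p : ℕ) : 𝓞 ℚ) ∈ v.asIdeal)
    (h : Module.finrank k (Representation.invariants (σ.toRepresentation.comp
        ((absGaloisRestrict ℚ (v.adicCompletion ℚ)).toMonoidHom.comp
          (absInertia (v.adicCompletion ℚ)).subtype))) ≠ 1 ∨
      Module.finrank k (Representation.invariants (σ'.toRepresentation.comp
        ((absGaloisRestrict ℚ (v.adicCompletion ℚ)).toMonoidHom.comp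
          (absInertia (v.adicCompletion ℚ)).subtype))) ≠ 1) :
    CruxAt p k red σ σ' := by
  intro _ _ hirr hirr' hdet _ hw _ _
  obtain ⟨ρ, hρ⟩ := hw
  obtain ⟨M, hM1, hM2, hM3, -⟩ :=
    stub_residualLattice p hp k red σ σ' ρ v hv (hρ.2.1 v hv).1 (hρ.2.1 v hv).2 hρ.2.2
  obtain ⟨h1, h2⟩ := finrank_invariants_inertia_eq_one hp σ σ' M v hv hirr hirr' hdet hM1 hM2 hM3
  exact (h.elim (fun h' => h' h1) (fun h' => h' h2)).elim

end Main

end Summit.Langlands.Langlands.Theorems.PhantomRMYoshida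

end
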